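import Summits.CriticalPhenomena.Ising3DConformalLimit.Theses.HyperoctahedralRP
import Summits.CriticalPhenomena.Ising3DConformalLimit.Theses.MirrorHoelderCompactness
import Literature.Probability.LatticeModels.CriticalUrsellFourSign
import Literature.Probability.LatticeModels.CriticalTwoPointBounds
import Literature.Probability.LatticeModels.HighDimPointwiseTriviality
import Literature.MathematicalPhysics.QuantumLattice.EuclideanAction
import Summits.CriticalPhenomena.Ising3DConformalLimit.Theorems.MoebiusLimitExists.Negative.FreeTranslations
import Summits.CriticalPhenomena.Ising3DConformalLimit.Theorems.MoebiusLimitExists.Negative.ScaleRedundant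
import Summits.CriticalPhenomena.Ising3DConformalLimit.Theorems.MoebiusLimitExists.Negative.TwoPointPositivity

/-!
# Block-zoom support layer for the crux `ExistsScaleCovariantLimit` (item stmt-CriticalPhenomena-1981)

Crux-plan output for the crux idea `block-zoom-exact-orbit` (planner, 2026-08-16). VERDICT: the idea is
NOT a stand-alone line (it owns no rigidity input; triage r1-1/r1-2: "support only, merge into
markov-zoom-rigidity", r1-3: fail (iv)); this file is the CHECKED SUPPORT LAYER it contributes to every
law-level existence line for this crux (markov-zoom-rigidity first), typed at the correlator level
(`criticalCorr`, `criticalTwoPoint`; no measure theory), sorry-free.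

BLOCK NORMALISATION. `rhoB δ := (δ³ · √(blockVar ⌊1/δ⌋₊))⁻¹`, `blockVar L := Σ_{x,y ∈ box 3 L} ⟨σ_xσ_y⟩_{β_c}`
(the variance of the block spin of `{−L,…,L}³`, `m*(β_c) = 0`), so that the smeared field
`Φ_δ(f) = rhoB(δ) δ³ Σ_x f(δx) σ_x` has `Var Φ_δ(𝟙_{[-1,1]³}) = 1` EXACTLY; its smeared moments are
`blockMoment δ n f` (a `tsum` of critical correlators against Schwartz test functions).

THE REDUCTION PROVED HERE (`existsScaleCovariantLimit_of_fieldMomentConvergence`):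
  SmearedToPointwise → NonWhiteSubsequence → NPointEquicontinuity → FieldMomentConvergence
    → HyperoctahedralRP.ExistsScaleCovariantLimit,
with `AutomaticCovariance` now a THEOREM (`automaticCovariance_holds`, from the landed Negative lemmas of the
sibling crux 1344: `Theorems/MoebiusLimitExists/Negative/{ScaleRedundant,FreeTranslations,TwoPointPositivity}`,
= Disproof.lean cycle 2 §A `iff_pure_existence`).
Status of the hypotheses (details in each docstring and in Lines/block-zoom-exact-orbit.md):
* PROVED here: `AutomaticCovariance` (`automaticCovariance_holds`), `rhoB_pos`;
* provable now (M): `UniformBounds`, `TopHeavyScales`, `SeparatedBlockCovariance`, `NonWhiteSubsequence`,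
  `BlockMomentBounds`, `ExactZoomIdentity`, `SmearedToPointwise` (glue),
  `OfStarRegularity` (glue), `IsolatedModulus` (L; the D-free nine-mirror modulus);
* OPEN and NOT this card's: `FieldMomentConvergence` (= smeared full-filter existence; needs a rigidity
  engine R — markov-zoom-rigidity's MI ∧ ZR ∧ ISO + ω-limit topology), and the caged part of
  `NPointEquicontinuity` (n-point asymptotic equicontinuity at mirror-caged configurations =
  route MirrorHoelderCompactness crux `NonSeparableModulus`, here WITHOUT its doubling hypothesis:
  `NPointEquicontinuity` ⟸ MirrorHoelderCompactness.UniformRegularity (item 4658) by `OfStarRegularity`).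
No statement below restates the crux, the summit, or a refuted statement (negatives index 2026-08-16: 9
CriticalPhenomena entries, all SAW/percolation/Cardy). Disproof.lean (cdisprove cycle 1 v1–v3 and cycle 2, published
2026-08-16T03:00Z) honoured: §A `iff_pure_existence` (crux ⟺ some full-filter limit with `S₂ ≢ 0`) is
exactly the shape the chain produces — the full-filter limit (FieldMomentConvergence + SmearedToPointwise)
AND `S₂ ≢ 0` (NonWhiteSubsequence); §E (`no_limit_of_hasDsiPair`: TI + point group + positivity + the two
power bounds + compactness cannot give the crux) is WHY `FieldMomentConvergence` is declared an external
input needing a DLR/Markov/geometric lever; §D/§F (axis regular variation) is an OUTPUT here.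
-/

noncomputable section

open Filter Topology
open Literature.Probability.LatticeModels

namespace Summit.CriticalPhenomena.Ising3DConformalLimit.Cruxes.ExistsScaleCovariantLimit.BlockZoomExactOrbit

/-! ### Block normalisation and smeared moments -/

/-- Lattice site `x ∈ ℤ³` as a point of `ℝ³` (same as the tree's `siteToE` / `siteVec`). -/
def toE (x : Site 3) : EuclideanSpace ℝ (Fin 3) := WithLp.toLp 2 fun i => (x i : ℝ)

/-- `blockVar L = Σ_{x,y ∈ box 3 L} ⟨σ_x σ_y⟩⁺_{β_c(3)}` — the variance of the block spin
`Σ_{x ∈ {−L,…,L}³} σ_x` at criticality (`⟨σ_x⟩_{β_c} = 0`; `criticalCorr_two_pair`). -/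
def blockVar (L : ℕ) : ℝ :=
  ∑ x ∈ box 3 L, ∑ y ∈ box 3 L, criticalTwoPoint 3 (y - x)

/-- The BLOCK RENORMALISATION `ρ_B(δ) = (δ³ √(blockVar ⌊δ⁻¹⌋₊))⁻¹`: the unique `ρ` making the variance
of the smeared unit block `Φ_δ(𝟙_{[-1,1]³}) = ρ δ³ Σ_{|x_i| ≤ 1/δ} σ_x` equal to `1`. -/
def rhoB (δ : ℝ) : ℝ := (δ ^ 3 * Real.sqrt (blockVar ⌊δ⁻¹⌋₊))⁻¹

/-- Smeared `n`-th moment of the block-normalised critical field at mesh `δ` against Schwartz test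
functions: `blockMoment δ n f = ρ_B(δ)ⁿ δ^{3n} Σ_{x ∈ (ℤ³)ⁿ} (∏ᵢ fᵢ(δ xᵢ)) ⟨∏ᵢ σ_{xᵢ}⟩⁺_{β_c(3)}`
(= `E[∏ᵢ Φ_δ(fᵢ)]`; absolutely convergent for Schwartz `fᵢ` since `|⟨∏σ⟩| ≤ 1`). -/
def blockMoment (δ : ℝ) (n : ℕ) (f : Fin n → SchwartzMap (EuclideanSpace ℝ (Fin 3)) ℝ) : ℝ :=
  rhoB δ ^ n * δ ^ (3 * n) * ∑' x : Fin n → Site 3, (∏ i, f i (δ • toE (x i))) * criticalCorr 3 n x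

/-- The block-normalised rescaled pointwise correlator `F^B_δ(n, x) = ρ_B(δ)ⁿ ⟨∏ σ_{⌊xᵢ/δ⌋}⟩_{β_c}`. -/
abbrev FB (n : ℕ) (δ : ℝ) (x : Fin n → EuclideanSpace ℝ (Fin 3)) : ℝ :=
  rescaledCorrelator (criticalCorr 3) rhoB n δ x

/-- The nine lattice mirror normals of `ℤ³` (B₃ arrangement): `e_i`, `e_i + e_j`, `e_i − e_j`. -/
def IsMirrorNormal (u : Site 3) : Prop :=
  ∃ i j : Fin 3, i ≠ j ∧ (u = Pi.single i 1 ∨ u = Pi.single i 1 + Pi.single j 1 ∨ u = Pi.single i 1 - Pi.single j 1)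

/-! ### (E) Exactness of the zoom orbit — provable now (S) -/

/-- **(E) EXACT ZOOM IDENTITY** (the card's lever (E), moment form; provable now, pure algebra on the
`tsum`): dilating the test functions by `c > 0` is the same as changing the mesh, up to the FORCED
constant `r_δ(c) = blockVar ⌊c/δ⌋₊ / blockVar ⌊1/δ⌋₊ = Var Φ_δ(𝟙_{[-c,c]³})`:
`blockMoment δ n (fᵢ(·/c)) = r_δ(c)^{n/2} · blockMoment (δ/c) n f`. Hence the self-normalised zoom
`T_c` maps the law of `Φ_δ` to the law of `Φ_{δ/c}` IDENTICALLY (no lattice rounding), the family is ONE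
orbit of an `ℝ₊`-action, and `r` is an exact cocycle: `r_δ(bc) = r_{δ/c}(b) · r_δ(c)`. -/
def ExactZoomIdentity : Prop :=
  ∀ (δ c : ℝ) (hc : 0 < c) (n : ℕ) (f : Fin n → SchwartzMap (EuclideanSpace ℝ (Fin 3)) ℝ), 0 < δ →
    blockMoment δ n (fun i => Literature.MathematicalPhysics.QuantumLattice.dilateTest c hc.ne' (f i)) =
      (blockVar ⌊c / δ⌋₊ / blockVar ⌊δ⁻¹⌋₊) ^ ((n : ℝ) / 2) * blockMoment (δ / c) n f

/-! ### (T) Tightness for free — provable now (M) -/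

/-- **(T) BLOCK MOMENT BOUNDS** (provable now; Griffiths + Newman, NO doubling): (a) the smeared sums
converge absolutely; (b) every smeared moment is bounded uniformly in `δ ∈ (0,1]` — cover `ℝ³` by unit
blocks, `Cov(block, block') ≤ √(Var·Var') = 1` by positive-definiteness of `⟨σ_xσ_y⟩` and the forced
normalisation, Schwartz decay sums the blocks, odd moments vanish (`m*(β_c)=0`), even ones are bounded by
Newman's pairing bound (tree: `PairIsing.avg_spinMonomial_le_pairingSum`, box limits); (c) Newman's
Gaussian domination of even moments for `f ≥ 0` (tree: `PairIsing.avg_pow_two_mul_le`):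
`E Φ_δ(f)^{2m} ≤ (2m−1)!! (sup_δ E Φ_δ(f)²)^m` — uniform integrability / sub-Gaussian tails, hence
tightness of the laws on `𝒮'(ℝ³)` with moment-determinate cluster points. [Newman1975Gaussian Thm 3;
Newman1975 Thm 5; AizenmanDuminilCopinAnnals2021 §1.2] -/
def BlockMomentBounds : Prop :=
  (∀ (n : ℕ) (f : Fin n → SchwartzMap (EuclideanSpace ℝ (Fin 3)) ℝ), ∀ δ ∈ Set.Ioc (0:ℝ) 1,
      Summable (fun x : Fin n → Site 3 => (∏ i, f i (δ • toE (x i))) * criticalCorr 3 n x)) ∧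
  (∀ (n : ℕ) (f : Fin n → SchwartzMap (EuclideanSpace ℝ (Fin 3)) ℝ), ∃ C : ℝ, ∀ δ ∈ Set.Ioc (0:ℝ) 1,
      |blockMoment δ n f| ≤ C) ∧
  (∀ f : SchwartzMap (EuclideanSpace ℝ (Fin 3)) ℝ, (∀ x, 0 ≤ f x) → ∃ C : ℝ, ∀ (m : ℕ), ∀ δ ∈ Set.Ioc (0:ℝ) 1,
      blockMoment δ (2 * m) (fun _ => f) ≤ (Nat.factorial (2 * m) : ℝ) / (2 ^ m * Nat.factorial m) * C ^ m)

/-! ### (W) A non-white cluster point — provable now (M) -/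

/-- **TOP-HEAVY SCALES** (ideator's lemma, triage-checked TRUE for every integer `m ≥ 1`; provable now from
`criticalTwoPoint_bounds_holds` + the sup-norm MMS comparison `twoPointPlus_le_of_mul_supNorm_le` + axis
monotonicity `twoPointPlus_add_single_le`): for infinitely many `L`, `c·χ_L ≤ L³·⟨σ₀σ_{mL e₁}⟩`,
`χ_L := Σ_{box 3 L} ⟨σ₀σ_x⟩`. Proof: otherwise the shell bound `χ_{2mL} − χ_{mL} ≤ (4mL+1)³ G(mL e₁) = o(χ_{mL})`
makes `χ_{m2^k} = 2^{o(k)}`, contradicting `χ_N ≥ cN` (from `G ≥ c‖x‖⁻²`). -/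
def TopHeavyScales : Prop :=
  ∀ m : ℕ, 1 ≤ m → ∃ c : ℝ, 0 < c ∧ ∃ᶠ L : ℕ in atTop,
    c * ∑ x ∈ box 3 L, criticalTwoPoint 3 x ≤ (L : ℝ) ^ 3 * criticalTwoPoint 3 (Pi.single 0 ((m : ℤ) * L))

/-- **SEPARATED BLOCK COVARIANCE** (provable now from `TopHeavyScales` with `m = 24`, the MMS bounds
`G(z) ≥ G(3‖z‖_∞ e₁)` (`twoPointPlus_diagAxis_le_of_mem_sphere`), `blockVar L ≤ (2L+1)³ χ_{2L}` and the
automatic susceptibility doubling `χ_{2L} ≤ C χ_L` (shell bound `χ_{2L} − χ_L ≤ (4L+1)³ G(Le₁)` + `L³G(Le₁) ≤ C′ χ_L` from `G(x) ≥ G(3‖x‖_∞e₁)` on `box ⌊L/3⌋`)): along infinitely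
many `L` the block `box 3 L` and its translate by `6L e₁` keep a covariance comparable to the block
variance: `c · blockVar L ≤ Σ_{x,y ∈ box 3 L} ⟨σ_x σ_{y + 6L e₁}⟩`. -/
def SeparatedBlockCovariance : Prop :=
  ∃ c : ℝ, 0 < c ∧ ∃ᶠ L : ℕ in atTop,
    c * blockVar L ≤ ∑ x ∈ box 3 L, ∑ y ∈ box 3 L, criticalTwoPoint 3 (y - x + Pi.single 0 (6 * (L : ℤ)))

/-- **(W) NON-WHITE SUBSEQUENCE** (provable now from `SeparatedBlockCovariance` along the meshes
`δ = 1/(8L)`: `box L ↦ [-1/8,1/8]³`, the translate `↦ [5/8,7/8]×[-1/8,1/8]²`, both inside the unit block;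
`blockVar (8L) ≤ 512² blockVar L` by covering + Cauchy–Schwarz; bumps `f ≥ 𝟙_{[-1/8,1/8]³}` supported in
`(-1/4,1/4)³`, `g = f(· − ¾e₁)`, all pair correlations `≥ 0` (`criticalCorr_two_nonneg`)): two
non-negative compactly supported test functions with DISJOINT supports whose smeared block-normalised
covariance stays `≥ c > 0` along a sequence of meshes `δ → 0⁺`. White noise gives `0` on disjoint
supports, so the cluster point along these meshes is not white noise. -/
def NonWhiteSubsequence : Prop :=
  ∃ (f g : SchwartzMap (EuclideanSpace ℝ (Fin 3)) ℝ), (∀ x, 0 ≤ f x) ∧ (∀ x, 0 ≤ g x) ∧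
    HasCompactSupport (f : EuclideanSpace ℝ (Fin 3) → ℝ) ∧ HasCompactSupport (g : EuclideanSpace ℝ (Fin 3) → ℝ) ∧
    Disjoint (tsupport (f : EuclideanSpace ℝ (Fin 3) → ℝ)) (tsupport (g : EuclideanSpace ℝ (Fin 3) → ℝ)) ∧
    ∃ c : ℝ, 0 < c ∧ ∃ᶠ δ in 𝓝[>] (0:ℝ), c ≤ blockMoment δ 2 ![f, g]

/-! ### (K2) Smeared-to-pointwise upgrade: compactness inputs -/

/-- **UNIFORM BOUNDS** of the block-normalised pointwise correlators on compacts of non-coincident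
configurations (provable now, NO doubling — contrast `MirrorHoelderCompactness.RescaledBounds`, which
needs `TwoPointDoubling` because of the normalisation `ρ★`): odd `n` vanish; even `n` by Newman's pairing
bound and the elementary `ρ_B(1/N)² ⟨σ₀σ_z⟩ ≤ (3/η)⁶` for `‖z‖_∞ ≥ ηN`
(`blockVar N ≥ Σ_{x,y ∈ box(ηN/6)} ≥ (ηN/3)⁶ G(ηN e₁)` and `G(z) ≤ G(‖z‖_∞e₁) ≤ G(ηN e₁)`). -/
def UniformBounds : Prop :=
  ∀ (n : ℕ) (K : Set (Fin n → EuclideanSpace ℝ (Fin 3))), K ⊆ NonCoincident 3 n → IsCompact K →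
    ∃ M δ₀ : ℝ, 0 < δ₀ ∧ ∀ δ ∈ Set.Ioo 0 δ₀, ∀ x ∈ K, |FB n δ x| ≤ M

/-- **ISOLATED-DIRECTION MODULUS** (the D-FREE nine-mirror modulus; provable track, L-sized; the block
framework's contribution to route MirrorHoelderCompactness, whose `SeparableHoelder` needs
`TwoPointDoubling`). If the point `x_i` is `m`-ISOLATED in the direction of a lattice mirror normal `u`
(`|⟨u, x_i − x_j⟩| ≥ m` for all `j ≠ i` — isolation of projections, weaker than extremality), then
lattice-exact shifts of `x_i` by `k δ u`, `|k|δ ≤ h₀`, change `F^B_δ(n,·)` by at most `C (|k| δ + δ)^{1/2}`,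
uniformly for `δ < δ₀` and `x` in a compact of non-coincident configurations. Mechanism (polarised
reflection positivity): translate the whole upper set `B = {j : ⟨u,x_j⟩ ≥ ⟨u,x_i⟩}` resp. `B ∖ {i}` along
`u` (exact lattice translations `θ_{k+1}θ_k = τ_u` for site planes `⟨u,·⟩ = k, k+1`); with the transfer
operator `0 ≤ T ≤ 1` of the RP form and Cauchy–Schwarz, `|⟨v,T^k w⟩ − ⟨v,T^{k+1}w⟩| ≤
√((c_j(v)−c_{j+1}(v))(c_j(w)−c_{j+1}(w))) ≤ √(c_j(v) c_j(w))/(k−j+1)`, `c_j(·)` plain correlations of a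
cluster against the `j`-translate of its mirror image, bounded by Newman's pairing bound and
`ρ_B² G ≤ (3/κ)⁶` at separation `κ` — NO doubling; or, operator-free, the Gram form of
`MirrorHoelderCompactness.MirrorCauchySchwarz` (Hölder 1/2). Single-point moves are differences of the
two cluster translations; the margins are exactly the isolation hypothesis. Inputs: nine-mirror RP of the
critical state (`CriticalCorrNineMirrorRP`, item 1985, provable from
`isingMeasure_univ_free_reflectionPositive`), Newman (`PairIsing.avg_spinMonomial_le_pairingSum`), MMS. -/
def IsolatedModulus : Prop :=
  ∀ (n : ℕ) (K : Set (Fin n → EuclideanSpace ℝ (Fin 3))), K ⊆ NonCoincident 3 n → IsCompact K →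
    ∀ m : ℝ, 0 < m → ∃ C δ₀ h₀ : ℝ, 0 < δ₀ ∧ 0 < h₀ ∧ ∀ δ ∈ Set.Ioo 0 δ₀, ∀ x ∈ K,
      ∀ (i : Fin n) (u : Site 3) (k : ℤ), IsMirrorNormal u → |(k : ℝ)| * δ ≤ h₀ →
        (∀ j : Fin n, j ≠ i → m ≤ |inner ℝ (toE u) (x i - x j)|) →
        |FB n δ (Function.update x i (x i + ((k : ℝ) * δ) • toE u)) - FB n δ x| ≤ C * (|(k : ℝ)| * δ + δ) ^ (1 / 2 : ℝ)

/-- **n-POINT ASYMPTOTIC EQUICONTINUITY** of the block-normalised correlators (=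
`ClusterRigidity.UniformRegularity` / `MirrorHoelderCompactness.UniformRegularity` clauses (a),(b), item
4658, with `ρ★ ↦ ρ_B`; NO lower bound (c) — under block normalisation bad scales give degenerate, not
divergent, limits). STATUS: (a) = `UniformBounds` (provable); (b) holds at every configuration all of
whose points have three independent isolated mirror directions (`IsolatedModulus`, D-free), and by
linear algebra of cluster translations at many resonant ones (e.g. the coordinate cross); it is OPEN at
mirror-CAGED configurations (all eight vertices of a cube, n = 8; grids) — exactly crux
`MirrorHoelderCompactness.NonSeparableModulus` ("maybe as hard as continuity of S"). Since
`ρ_B ≤ C ρ★` always, this statement is IMPLIED by item 4658 (`OfStarRegularity`). -/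
def NPointEquicontinuity : Prop :=
  ∀ (n : ℕ) (K : Set (Fin n → EuclideanSpace ℝ (Fin 3))), K ⊆ NonCoincident 3 n → IsCompact K →
    (∃ M δ₀ : ℝ, 0 < δ₀ ∧ ∀ δ ∈ Set.Ioo 0 δ₀, ∀ x ∈ K, |FB n δ x| ≤ M) ∧
    (∀ ε : ℝ, 0 < ε → ∃ r δ₀ : ℝ, 0 < r ∧ 0 < δ₀ ∧ ∀ δ ∈ Set.Ioo 0 δ₀, ∀ x ∈ K, ∀ y ∈ K,
      dist x y < r → |FB n δ x - FB n δ y| < ε)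

/-- **GLUE (provable now, S): block equicontinuity from the shared compactness milestone.** Since
`ρ_B(δ)/ρ★(δ) = (⟨σ₀σ_{Ne₁}⟩ N⁶ / blockVar N)^{1/2} ≤ C` for all `N = ⌊1/δ⌋` (from
`blockVar N ≥ (N/3)⁶ G(N e₁)`, MMS), `NPointEquicontinuity` follows from item 4658
`MirrorHoelderCompactness.UniformRegularity` (a),(b) — so the caged-modulus problem is SHARED, not new. -/
def OfStarRegularity : Prop :=
  Summit.CriticalPhenomena.Ising3DConformalLimit.Theses.MirrorHoelderCompactness.UniformRegularity →
    NPointEquicontinuity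

/-! ### (K2) The upgrade and the interface -/

/-- **FIELD MOMENT CONVERGENCE — THE INTERFACE, NOT A LEMMA OF THIS LAYER.** Every smeared moment of the
block-normalised critical field converges along the FULL filter `δ → 0⁺`. This is the smeared
(law-level) existence problem for the forced normalisation `ρ_B`; by `(T)` it is equivalent to
convergence in law of the block-normalised fields to one (moment-determinate) law `μ*`. It is what a
RIGIDITY ENGINE must deliver: tightness `(T)` + exact orbit `(E)` make the law-cluster set compact,
connected and zoom-invariant; [cluster points ∈ 𝒳] ∧ [ω-limit-shaped subsets of 𝒳 are zoom-fixed] ∧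
[Fix ∩ 𝒳 totally disconnected] (markov-zoom-rigidity: MI_sub ∧ ZR ∧ ISO, 𝒳 = TI + RP + germ-Markov +
sharp Gaussian domination + unit block variance) then force a single cluster point. Stated R-agnostically
it would restate the smeared crux (triage r1-3), which is why THIS card opens no line of its own. -/
def FieldMomentConvergence : Prop :=
  ∀ (n : ℕ) (f : Fin n → SchwartzMap (EuclideanSpace ℝ (Fin 3)) ℝ), ∃ M : ℝ,
    Tendsto (fun δ => blockMoment δ n f) (𝓝[>] (0:ℝ)) (𝓝 M)

/-- **(K2) SMEARED-TO-POINTWISE UPGRADE** (provable now GIVEN its three hypotheses; M-sized glue):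
full-filter convergence of the smeared moments + asymptotic equicontinuity and bounds on compacts of
`NonCoincident` ⇒ the block-normalised POINTWISE correlators converge locally uniformly, for every `n`, to
continuous limits `S n` (Arzelà–Ascoli extraction as in the tree's
`exists_subseq_tendstoUniformlyOn_of_asympEquicontinuous`; two subsequential limits have the same integrals
against products of disjointly supported bumps — Riemann sums of `blockMoment` — hence agree on
`NonCoincident` by continuity; full-filter convergence by the proved subsequence principle
`Literature.Barriers.CriticalPhenomena.hasPointwiseScalingLimit_of_seq_subseq`), and `S 2 ≢ 0` off the
diagonal by `NonWhiteSubsequence` (`∫∫ f g S₂ ≥ c > 0`). No doubling hypothesis: all-scale regularity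
is OUTPUT (`exists_rpow_scale_and_ratio`). -/
def SmearedToPointwise : Prop :=
  FieldMomentConvergence → NonWhiteSubsequence → NPointEquicontinuity →
    ∃ S : CorrFamily 3, HasPointwiseScalingLimit (criticalCorr 3) rhoB S ∧
      (∀ n, ContinuousOn (S n) (NonCoincident 3 n)) ∧ ∃ x ∈ NonCoincident 3 2, S 2 x ≠ 0

/-- **AUTOMATIC COVARIANCE** (ideator's lemma, SketchIdeator3.lean; triage-checked ×3; PROVED below as
`automaticCovariance_holds` from the landed Negative lemmas `exists_scaleCovariant_normalised`,
`isTranslationInvariant_normalised_of_limit`, `isNondegenerateTwoPoint_iff_exists_pos`, `limit_two_nonneg`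
— the continuity hypothesis is not even needed). For ANY `ρ > 0` on `(0,1]`: a full-filter pointwise limit
with `S 2 ≢ 0` already yields every clause of the crux for the normalised family `S·𝟙_{NonCoincident}`. -/
def AutomaticCovariance : Prop :=
  ∀ (ρ : ℝ → ℝ) (S : CorrFamily 3), (∀ δ ∈ Set.Ioc (0:ℝ) 1, 0 < ρ δ) →
    HasPointwiseScalingLimit (criticalCorr 3) ρ S →
    (∀ n, ContinuousOn (S n) (NonCoincident 3 n)) →
    (∃ x ∈ NonCoincident 3 2, S 2 x ≠ 0) →
    ∃ Δ : ℝ, 1/2 ≤ Δ ∧ Δ ≤ 1 ∧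
      HasPointwiseScalingLimit (criticalCorr 3) ρ (fun n => (NonCoincident 3 n).indicator (S n)) ∧
      (∀ n z, z ∉ NonCoincident 3 n → (fun n => (NonCoincident 3 n).indicator (S n)) n z = 0) ∧
      IsNondegenerateTwoPoint (fun n => (NonCoincident 3 n).indicator (S n)) ∧
      IsTranslationInvariant (fun n => (NonCoincident 3 n).indicator (S n)) ∧
      IsScaleCovariant Δ (fun n => (NonCoincident 3 n).indicator (S n))

section
open Classical
open Summit.CriticalPhenomena.Ising3DConformalLimit.MoebiusLimitExistsNegative

/-- `AutomaticCovariance` is a theorem (landed Negative lemmas of crux 1344 = Disproof §A). -/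
theorem automaticCovariance_holds : AutomaticCovariance := by
  intro ρ S hρ hlim _hcont hnw
  obtain ⟨x, hx, hne⟩ := hnw
  have hpos : 0 < S 2 x := lt_of_le_of_ne (limit_two_nonneg hlim hx) (Ne.symm hne)
  have hnd : IsNondegenerateTwoPoint S := (isNondegenerateTwoPoint_iff_exists_pos hlim).2 ⟨x, hx, hpos⟩
  obtain ⟨Δ, hwin, hsc⟩ := exists_scaleCovariant_normalised hρ hlim hnd
  have key : (fun n => (NonCoincident 3 n).indicator (S n)) =
      (fun n x => if x ∈ NonCoincident 3 n then S n x else 0) := by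
    funext n x
    exact Set.indicator_apply _ _ _
  refine ⟨Δ, hwin.1, hwin.2, ?_, ?_, ?_, ?_, ?_⟩
  · rw [key]; exact normalised_hasLimit hlim
  · intro n z hz
    show (NonCoincident 3 n).indicator (S n) z = 0
    exact Set.indicator_of_notMem hz _
  · rw [key]; exact normalised_nondeg hnd
  · rw [key]; exact isTranslationInvariant_normalised_of_limit hlim
  · rw [key]; exact hsc

end

/-! ### Positivity of the block renormalisation (proved) -/

theorem blockVar_nonneg (L : ℕ) : 0 ≤ blockVar L := by
  unfold blockVar
  refine Finset.sum_nonneg fun x _ => Finset.sum_nonneg fun y _ => ?_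
  have h := criticalCorr_two_nonneg (d := 3) x y
  rw [criticalCorr_two_pair] at h
  exact h

theorem blockVar_pos {L : ℕ} (hL : 1 ≤ L) : 0 < blockVar L := by
  classical
  -- the pair `(0, e₁)` contributes `⟨σ₀σ_{e₁}⟩ ≥ c‖e₁‖⁻² > 0`
  obtain ⟨c, C, hc, hb⟩ := criticalTwoPoint_bounds_holds (d := 3) (by norm_num)
  have he : (Pi.single 0 1 : Site 3) ≠ 0 := by
    intro h; have := congrFun h 0; simp at this
  have hpos : 0 < criticalTwoPoint 3 (Pi.single 0 1) := by
    have h1 := (hb _ he).1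
    have hn : (0:ℝ) < (‖(Pi.single 0 1 : Site 3)‖ : ℝ) := by
      have : ‖(Pi.single 0 1 : Site 3)‖ ≠ 0 := norm_ne_zero_iff.2 he
      positivity
    have : 0 < c * (‖(Pi.single 0 1 : Site 3)‖ : ℝ) ^ (-((3:ℝ) - 1)) :=
      mul_pos hc (Real.rpow_pos_of_pos hn _)
    have h1' : c * (‖(Pi.single 0 1 : Site 3)‖ : ℝ) ^ (-(((3:ℕ):ℝ) - 1)) ≤ criticalTwoPoint 3 (Pi.single 0 1) := h1
    push_cast at h1'
    linarith
  have h0 : (0 : Site 3) ∈ box 3 L := by simp [mem_box]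
  have h1 : (Pi.single 0 1 : Site 3) ∈ box 3 L := by
    rw [mem_box]; intro i
    by_cases hi : i = 0
    · subst hi; simp; omega
    · simp [hi]
  unfold blockVar
  have hterm : ∀ x ∈ box 3 L, ∀ y ∈ box 3 L, 0 ≤ criticalTwoPoint 3 (y - x) := by
    intro x _ y _
    have h := criticalCorr_two_nonneg (d := 3) x y
    rw [criticalCorr_two_pair] at h
    exact h
  calc (0:ℝ) < criticalTwoPoint 3 (Pi.single 0 1 - 0) := by simpa using hpos
    _ ≤ ∑ y ∈ box 3 L, criticalTwoPoint 3 (y - 0) :=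
        Finset.single_le_sum (f := fun y => criticalTwoPoint 3 (y - 0)) (fun y hy => hterm 0 h0 y hy) h1
    _ ≤ ∑ x ∈ box 3 L, ∑ y ∈ box 3 L, criticalTwoPoint 3 (y - x) :=
        Finset.single_le_sum (f := fun x => ∑ y ∈ box 3 L, criticalTwoPoint 3 (y - x))
          (fun x hx => Finset.sum_nonneg fun y hy => hterm x hx y hy) h0

/-- `ρ_B > 0` on `(0,1]` (then `⌊δ⁻¹⌋₊ ≥ 1` and `blockVar ≥ ⟨σ₀σ_{e₁}⟩ > 0`). -/
theorem rhoB_pos {δ : ℝ} (hδ : δ ∈ Set.Ioc (0:ℝ) 1) : 0 < rhoB δ := by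
  unfold rhoB
  have hL : 1 ≤ ⌊δ⁻¹⌋₊ := by
    have : (1:ℝ) ≤ δ⁻¹ := one_le_inv_iff₀.2 ⟨hδ.1, hδ.2⟩
    exact Nat.one_le_floor_iff _ |>.2 this
  have hv := blockVar_pos hL
  have : 0 < δ ^ 3 * Real.sqrt (blockVar ⌊δ⁻¹⌋₊) := mul_pos (pow_pos hδ.1 3) (Real.sqrt_pos.2 hv)
  exact inv_pos.2 this

/-! ### The proved reduction -/

/-- **REDUCTION (kernel-checked).** The block-zoom support layer turns the crux into: FULL-FILTER
CONVERGENCE OF THE SMEARED BLOCK-NORMALISED MOMENTS (`FieldMomentConvergence`, to be supplied by a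
rigidity engine) + n-point asymptotic equicontinuity (`NPointEquicontinuity`, provable off caged
configurations, implied by the shared item 4658) + two provable lemmas (`SmearedToPointwise` glue,
`NonWhiteSubsequence`); covariance, `Δ`, normalisation and `ρ_B > 0` are theorems. -/
theorem existsScaleCovariantLimit_of_fieldMomentConvergence
    (hK2 : SmearedToPointwise) (hW : NonWhiteSubsequence) (hE : NPointEquicontinuity)
    (hFC : FieldMomentConvergence) :
    Summit.CriticalPhenomena.Ising3DConformalLimit.Theses.HyperoctahedralRP.ExistsScaleCovariantLimit := by
  obtain ⟨S, hlim, hcont, hnw⟩ := hK2 hFC hW hE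
  have hρ : ∀ δ ∈ Set.Ioc (0:ℝ) 1, 0 < rhoB δ := fun δ hδ => rhoB_pos hδ
  obtain ⟨Δ, hΔ, -, hlim', hnorm, hnd, htr, hsc⟩ := automaticCovariance_holds rhoB S hρ hlim hcont hnw
  exact ⟨rhoB, Δ, _, hρ, by linarith, hlim', hnorm, hnd, htr, hsc⟩

/-- The same reduction with the equicontinuity input taken from the SHARED compactness milestone
(item 4658, `MirrorHoelderCompactness.UniformRegularity` = `ClusterRigidity.UniformRegularity`). -/
theorem existsScaleCovariantLimit_of_fieldMomentConvergence'
    (hK2 : SmearedToPointwise) (hW : NonWhiteSubsequence) (hG : OfStarRegularity)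
    (hReg : Summit.CriticalPhenomena.Ising3DConformalLimit.Theses.MirrorHoelderCompactness.UniformRegularity)
    (hFC : FieldMomentConvergence) :
    Summit.CriticalPhenomena.Ising3DConformalLimit.Theses.HyperoctahedralRP.ExistsScaleCovariantLimit :=
  existsScaleCovariantLimit_of_fieldMomentConvergence hK2 hW (hG hReg) hFC

end Summit.CriticalPhenomena.Ising3DConformalLimit.Cruxes.ExistsScaleCovariantLimit.BlockZoomExactOrbit

end
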